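import Mathlib
import HarnessLib
import Summits.HubbardSuperconductivity.HubbardSuperconductivity.Theorems.KLProgrammeThermalTwoPointMomentumDefs
import Literature.MathematicalPhysics.QuantumLattice.HubbardSchwingerFunction

/-!
# Route `KLProgramme` — `ThermalTwoPointMomentum`: the bridge to the tree's time-ordered Schwinger function

`Theorems/KLProgrammeThermalTwoPointMomentumDefs.lean` (p419909) defines the imaginary-time two-point function
`hubbardThermalTwoPointTime β U μ L τ x y σ σ' = ⟨c†_{xσ}(τ) c_{yσ'}(0)⟩ = Z⁻¹ Tr(e^{-(β-τ)H} c†_{xσ} e^{-τH} c_{yσ'})`.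
The tree ALREADY carries BGM's time-ordered two-point (Schwinger) function
`hubbardSchwingerTwoPoint β U μ L x₀ x σ y₀ y σ' = ⟨T a_{xσ}(x₀) a†_{yσ'}(y₀)⟩` (`Literature…HubbardSchwingerFunction.lean`,
BGM 2006 (1.2)–(1.3), with KMS antiperiodicity and time-translation invariance proved).  This file PROVES that the two are
the same object up to the fermionic ordering sign, so that consumers of either inherit the other's API (and no parallel
theory is grown on the convenience form):

* `hubbardThermalTwoPointTime_eq_neg_schwinger` — for `0 ≤ τ`:
  `⟨c†_{xσ}(τ) c_{yσ'}(0)⟩_{β,L} = - S^{β,L}((0,y⃗),σ',-; (τ,x⃗),σ,+)`, i.e.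
  `hubbardThermalTwoPointTime β U μ L τ x y σ σ' = - hubbardSchwingerTwoPoint β U μ L 0 y σ' τ x σ`;
(For `τ < 0` the time-ordered function is the OTHER operator order `⟨c_{yσ'} c†_{xσ}(τ)⟩`; only `τ ∈ [0, β]` is used.)

Everything is proved; no definitions; no named facts. [folklore]
-/

noncomputable section

namespace Summit.HubbardSuperconductivity.HubbardSuperconductivity.Theorems.KLProgrammeTwoPoint

set_option linter.dupNamespace false -- summit = problem name (single-conjunct summit), D-0017

open Matrix NormedSpace
open Literature.MathematicalPhysics.QuantumLattice Literature.Probability.LatticeModels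

/-- `e^{-(β-τ)H} = e^{-βH} e^{τH}` (the two exponents commute). [folklore] -/
theorem gibbsWeight_sub {n : Type*} [Fintype n] [DecidableEq n] (β τ : ℝ) (H : Matrix n n ℂ) :
    gibbsWeight (β - τ) H = gibbsWeight β H * exp ((τ : ℂ) • H) := by
  rw [gibbsWeight, gibbsWeight, ← Matrix.exp_add_of_commute _ _ (((Commute.refl H).smul_left _).smul_right _)]
  congr 1
  push_cast
  rw [show -((β : ℂ) - τ) = -(β : ℂ) + τ by ring, add_smul]

/-- `e^{-τH}` is the Gibbs weight at `τ`: `exp (-(τ • H)) = gibbsWeight τ H`. [folklore] -/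
theorem exp_neg_smul_eq_gibbsWeight {n : Type*} [Fintype n] [DecidableEq n] (τ : ℝ) (H : Matrix n n ℂ) :
    exp (-((τ : ℂ) • H)) = gibbsWeight τ H := by
  rw [gibbsWeight, neg_smul]

/-- **The bridge** (`0 ≤ τ`): `⟨c†_{xσ}(τ) c_{yσ'}(0)⟩_{β,L} = - ⟨T a_{yσ'}(0) a†_{xσ}(τ)⟩_{β,L}`, i.e.
`hubbardThermalTwoPointTime β U μ L τ x y σ σ' = - hubbardSchwingerTwoPoint β U μ L 0 y σ' τ x σ` (at `τ = 0` this is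
`hubbardSchwingerTwoPoint_self` read through `hubbardThermalTwoPointTime_zero`). [cite: BenfattoGiulianiMastropietro2006, §1.2 (1.2)–(1.3)] -/
theorem hubbardThermalTwoPointTime_eq_neg_schwinger (β U μ : ℝ) (L : ℕ) {τ : ℝ} (hτ : 0 ≤ τ) (x y : Site 2)
    (σ σ' : Fin 2) :
    hubbardThermalTwoPointTime β U μ L τ x y σ σ' = -hubbardSchwingerTwoPoint β U μ L 0 y σ' τ x σ := by
  by_cases hL : L = 0
  · subst hL; simp [hubbardSchwingerTwoPoint]
  · haveI : NeZero L := ⟨hL⟩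
    rw [hubbardSchwingerTwoPoint_eq, Matrix.schwingerTwoPoint_of_le _ _ _ _ hτ, neg_neg, hubbardThermalTwoPointTime,
      dif_neg hL, gibbsState_apply, imagTimeEvolve_eq, imagTimeEvolve_eq, gibbsWeight_sub, exp_neg_smul_eq_gibbsWeight]
    simp only [Complex.ofReal_zero, zero_smul, neg_zero, NormedSpace.exp_zero, one_mul, mul_one, Matrix.mul_assoc]

end Summit.HubbardSuperconductivity.HubbardSuperconductivity.Theorems.KLProgrammeTwoPoint

end
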